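import Literature.MathematicalPhysics.QuantumFieldTheory.Balaban1983to89.T4ExpWindowSmallField
import Literature.MathematicalPhysics.QuantumFieldTheory.Balaban1983to89.T3ContinuumYM3Torus
import HarnessLib

/-!
# (BG∞) ∕ `hsupp⁺` — THE TRIVIAL REGIMES OF THE `√θ`-GAUGE LETTER `hBG`: on SMALL TORI (`N ≤ N₀`) and at LARGE WINDOWS (`θ ≥ θ₀`) the bound
# `arc((u•V) e) ≤ C·√θ + c∕N` holds with `u := 1` as soon as `c ≥ N₀·π`, resp. `C·√θ₀ ≥ π` — because every arc is `≤ π`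

Cell `ym3-torus` (YM ladder rung R3 = continuum `SU(2)` Yang–Mills on the three-torus at fixed lattice data — a RUNG: NOT d = 4, NOT infinite volume, NOT a mass gap,
NOT Clay).  Width seat «width 5» `ym3-torus-px5` (gen 24), FREE px helper on crux `stmt-QuantumFields-20520` (`…Theses.UnitScaleTilt.FluctuationComparisonRegPrIntL`);
`--kind proof --supports stmt-QuantumFields-20520 --as helper`, count-neutral, DEFINITION-FREE (0 `def`, 0 `instance`, 0 `notation`, 0 `sorry`; default heartbeats).

WHY (desk RULING №127 R3∕R4, 2026-09-01 01:06Z; this seat's FINDING «(GS) CASE S IS NOT A SEPARATE CONSTRUCTION» 01:08:08Z).  The (BG∞) road's one supplier conjecture is LEAD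
w3 g29's `hBG` binder (✓p838715 `…FlooredSupplierOfSqrtGauge`): `∀ F J θ > 0, ∀ V, PlaqSmall θ V → ∃ u, ∀ e, ‖logVec (su2Quat ((u•V) e))‖ ≤ C·√θ + c ∕ N_J`,
`N_J := (F.P J).sitesPerDir 0`.  Its plan of record (px19 g25 UV3-NODE §116.3) glues block-axial gauges at scale `ρ = ⌊c₀∕√θ⌋` on tori with `N ≥ 8ρ` (Case L) and
listed a separate «Case S» (`N < 8ρ`: comb gauge + distributed Polyakov roots — `stub_combPolyakov`).  Case S is not needed: Case L run at the smaller block side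
`ρ′ := min(ρ, ⌊N∕8⌋)` covers every `N ≥ 8` with `θ ≤ c₀²` (its bound `7ρ′θ + K∕ρ′ ≤ 7c₀√θ + K·max(2√θ∕c₀, 16∕N)` is of `hBG`'s shape — the `c∕N` term is born in the
fillings at `ρ′ ≍ N∕8`), and what is left — tori with `N ≤ 7`, windows with `θ > c₀²` — is covered by the SIZE of the constants alone, since every arc on `SU(2)` is `≤ π`
(lit ✓`norm_logVec_le_pi`).  THIS FILE types those two trivial regimes in `hBG`'s consequent shape, with the constants as FREE parameters under the one inequality each
regime needs, so that the final assembly (G8) case-splits into them by `exact` after choosing `C ≥ π∕√θ₀` and `c ≥ N₀·π`.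

WHAT IS PROVED (sorry-free; `SU2`-valued fields; `u := 1` throughout).
★ `norm_logVec_gaugeAct_le_pi` (every gauged bond has arc `≤ π`); the ONE-CONSTANT forms ★`norm_logVec_gaugeAct_le_mul_one_div` (`N ≤ N₀ ⟹ arc ≤ (N₀π)·(1∕N)`, every gauge)
and ★`norm_logVec_gaugeAct_le_mul_sqrt` (`0 < θ₀ ≤ θ ⟹ arc ≤ (π∕√θ₀)·√θ`, every gauge); the TWO-CONSTANT forms ★★ `exists_gauge_sqrtBound_of_sitesPerDir_le` (SMALL TORUS: `N ≤ N₀`, `0 < N`, `0 ≤ C`, `N₀·π ≤ c` ⟹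
`∃ u, ∀ e, arc ≤ C·√θ + c∕N`); ★★ `exists_gauge_sqrtBound_of_le_theta` (LARGE WINDOW: `θ₀ ≤ θ`, `0 ≤ c`, `0 < N`, `π ≤ C·√θ₀` ⟹ the same); ★★ `exists_gauge_sqrtBound_of_trivialRegime`
(the disjunction `N ≤ N₀ ∨ θ₀ ≤ θ` under both constant conditions) — all three for the `T3Family` member lattices `F.P J` with `N := (F.P J).sitesPerDir 0` spelled as in `hBG`.

DOMAIN SENTENCE (RULING №115 R5).  Trivial regimes only; the substantive regime `N ≥ 8`, `θ ≤ c₀²` is Case L of §116.3 ((G6) ⧗ px19, (G7)-lattice∕(G8) → (P7)); nothing of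
`hBG`'s content is proved here.

HONEST SCOPE.  [folklore] «every rotation angle is at most π»; `hsupp⁺`∕`hBG` is a CONJECTURE with a plan (§116) and numerics (FL-39∕40), NOT proved; nothing of Bałaban's
renormalisation-group analysis asserted or proved ([Balaban1985RegularSpaces] (1.29) p.81: the printed local small-bond gauges); `hsupp^{≥J₀}`, hD, hDBX, h3 HYPOTHESES; GAP♯∘
(registry v11 3732b7df; v12.1 adopted-in-waiting), the five registered stubs (0∕5), S2β, 20520, 19936, 19200, `YM3TorusSU2` NOT proved; no registered stub closed; rung R3 —
NOT d = 4, NOT infinite volume, NOT a mass gap, NOT Clay; the Yang–Mills mass gap is NOT proved.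
-/

set_option autoImplicit false

noncomputable section

namespace Summit.QuantumFields.YangMills.Theorems.FluctuationComparisonRegPrIntLS2BetaSqrtGaugeTrivialRegimes

open scoped Real
open Literature.MathematicalPhysics.QuantumLattice (su2Quat)
open Literature.MathematicalPhysics.QuantumFieldTheory.Balaban1983to89
open T3ContinuumYM3Torus (T3Family)
open T4ExpWindowSmallField (logVec norm_logVec_le_pi)

/-- ★ Every gauged bond variable has arc `≤ π` (lit ✓`norm_logVec_le_pi`). [folklore] -/
theorem norm_logVec_gaugeAct_le_pi {P : Params} {j : ℕ} (u : GaugeTransf P j (Matrix.specialUnitaryGroup (Fin 2) ℂ))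
    (V : GaugeField P j (Matrix.specialUnitaryGroup (Fin 2) ℂ)) (e : PBond P j) :
    ‖logVec (su2Quat (GaugeField.gaugeAct u V e))‖ ≤ π :=
  norm_logVec_le_pi _

/-- ★ **SMALL TORUS, ONE-CONSTANT FORM**: `N ≤ N₀`, `0 < N` ⟹ every gauged bond has arc `≤ (N₀·π)·(1∕N)` (for EVERY gauge `u`, in particular `u := 1`). [folklore] -/
theorem norm_logVec_gaugeAct_le_mul_one_div (F : T3Family) (J : ℕ) {N₀ : ℕ} (hN : (F.P J).sitesPerDir 0 ≤ N₀) (hNpos : 0 < (F.P J).sitesPerDir 0)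
    (u : GaugeTransf (F.P J) 0 (Matrix.specialUnitaryGroup (Fin 2) ℂ)) (V : GaugeField (F.P J) 0 (Matrix.specialUnitaryGroup (Fin 2) ℂ)) (e : PBond (F.P J) 0) :
    ‖logVec (su2Quat (GaugeField.gaugeAct u V e))‖ ≤ ((N₀ : ℝ) * π) * (1 / (((F.P J).sitesPerDir 0 : ℕ) : ℝ)) := by
  refine (norm_logVec_gaugeAct_le_pi u V e).trans ?_
  have hN' : (0 : ℝ) < ((F.P J).sitesPerDir 0 : ℕ) := by exact_mod_cast hNpos
  have hNle : (((F.P J).sitesPerDir 0 : ℕ) : ℝ) ≤ N₀ := by exact_mod_cast hN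
  rw [mul_one_div, le_div_iff₀ hN']
  calc π * (((F.P J).sitesPerDir 0 : ℕ) : ℝ) ≤ π * N₀ := mul_le_mul_of_nonneg_left hNle Real.pi_pos.le
    _ = (N₀ : ℝ) * π := mul_comm _ _

/-- ★ **LARGE WINDOW, ONE-CONSTANT FORM**: `0 < θ₀ ≤ θ` ⟹ every gauged bond has arc `≤ (π∕√θ₀)·√θ` (for EVERY gauge `u`). [folklore] -/
theorem norm_logVec_gaugeAct_le_mul_sqrt {P : Params} {j : ℕ} {θ₀ θ : ℝ} (hθ₀ : 0 < θ₀) (hθ : θ₀ ≤ θ)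
    (u : GaugeTransf P j (Matrix.specialUnitaryGroup (Fin 2) ℂ)) (V : GaugeField P j (Matrix.specialUnitaryGroup (Fin 2) ℂ)) (e : PBond P j) :
    ‖logVec (su2Quat (GaugeField.gaugeAct u V e))‖ ≤ (π / Real.sqrt θ₀) * Real.sqrt θ := by
  refine (norm_logVec_gaugeAct_le_pi u V e).trans ?_
  have hs0 : 0 < Real.sqrt θ₀ := Real.sqrt_pos.2 hθ₀
  have hsq : Real.sqrt θ₀ ≤ Real.sqrt θ := Real.sqrt_le_sqrt hθ
  calc π = (π / Real.sqrt θ₀) * Real.sqrt θ₀ := by field_simp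
    _ ≤ (π / Real.sqrt θ₀) * Real.sqrt θ := mul_le_mul_of_nonneg_left hsq (by positivity)

/-- ★★ **THE SMALL-TORUS REGIME**: on a member lattice with `N := (F.P J).sitesPerDir 0 ≤ N₀` (and `0 < N`), for any `C ≥ 0`, any `θ`, and any `c ≥ N₀·π`, the trivial gauge
already satisfies `hBG`'s bound: `arc ≤ π ≤ N₀π∕N ≤ C·√θ + c∕N`. [folklore] -/
theorem exists_gauge_sqrtBound_of_sitesPerDir_le (F : T3Family) (J : ℕ) {N₀ : ℕ} (hN : (F.P J).sitesPerDir 0 ≤ N₀) (hNpos : 0 < (F.P J).sitesPerDir 0)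
    {C c θ : ℝ} (hC : 0 ≤ C) (hc : (N₀ : ℝ) * π ≤ c) (V : GaugeField (F.P J) 0 (Matrix.specialUnitaryGroup (Fin 2) ℂ)) :
    ∃ u : GaugeTransf (F.P J) 0 (Matrix.specialUnitaryGroup (Fin 2) ℂ),
      ∀ e, ‖logVec (su2Quat (GaugeField.gaugeAct u V e))‖ ≤ C * Real.sqrt θ + c / (((F.P J).sitesPerDir 0 : ℕ) : ℝ) := by
  refine ⟨fun _ => 1, fun e => (norm_logVec_gaugeAct_le_pi _ V e).trans ?_⟩
  have hN' : (0 : ℝ) < ((F.P J).sitesPerDir 0 : ℕ) := by exact_mod_cast hNpos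
  have hNle : (((F.P J).sitesPerDir 0 : ℕ) : ℝ) ≤ N₀ := by exact_mod_cast hN
  have h1 : π ≤ c / (((F.P J).sitesPerDir 0 : ℕ) : ℝ) := by
    rw [le_div_iff₀ hN']
    calc π * (((F.P J).sitesPerDir 0 : ℕ) : ℝ) ≤ π * N₀ := mul_le_mul_of_nonneg_left hNle Real.pi_pos.le
      _ = (N₀ : ℝ) * π := mul_comm _ _
      _ ≤ c := hc
  have h2 : 0 ≤ C * Real.sqrt θ := mul_nonneg hC (Real.sqrt_nonneg _)
  linarith

/-- ★★ **THE LARGE-WINDOW REGIME**: if `θ₀ ≤ θ` and `π ≤ C·√θ₀` (so `θ₀ > 0` automatically), then for any `c ≥ 0` the trivial gauge satisfies `hBG`'s bound on every member lattice with `0 < N`: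
`arc ≤ π ≤ C√θ₀ ≤ C√θ ≤ C·√θ + c∕N`. [folklore] -/
theorem exists_gauge_sqrtBound_of_le_theta (F : T3Family) (J : ℕ) (hNpos : 0 < (F.P J).sitesPerDir 0) {θ₀ θ C c : ℝ} (hθ : θ₀ ≤ θ)
    (hC : π ≤ C * Real.sqrt θ₀) (hc : 0 ≤ c) (V : GaugeField (F.P J) 0 (Matrix.specialUnitaryGroup (Fin 2) ℂ)) :
    ∃ u : GaugeTransf (F.P J) 0 (Matrix.specialUnitaryGroup (Fin 2) ℂ),
      ∀ e, ‖logVec (su2Quat (GaugeField.gaugeAct u V e))‖ ≤ C * Real.sqrt θ + c / (((F.P J).sitesPerDir 0 : ℕ) : ℝ) := by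
  refine ⟨fun _ => 1, fun e => (norm_logVec_gaugeAct_le_pi _ V e).trans ?_⟩
  have hN' : (0 : ℝ) < ((F.P J).sitesPerDir 0 : ℕ) := by exact_mod_cast hNpos
  have hC0 : 0 ≤ C := by
    by_contra hneg
    push Not at hneg
    have : C * Real.sqrt θ₀ ≤ 0 := mul_nonpos_of_nonpos_of_nonneg hneg.le (Real.sqrt_nonneg _)
    linarith [Real.pi_pos]
  have hsq : Real.sqrt θ₀ ≤ Real.sqrt θ := Real.sqrt_le_sqrt hθ
  have h1 : C * Real.sqrt θ₀ ≤ C * Real.sqrt θ := mul_le_mul_of_nonneg_left hsq hC0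
  have h2 : 0 ≤ c / (((F.P J).sitesPerDir 0 : ℕ) : ℝ) := div_nonneg hc hN'.le
  linarith

/-- ★★ **BOTH TRIVIAL REGIMES AT ONCE** (the shape (G8) case-splits into): under `0 ≤ C`, `π ≤ C·√θ₀`, `N₀·π ≤ c`, on a member lattice with `0 < N` and EITHER `N ≤ N₀` OR `θ₀ ≤ θ`,
the trivial gauge satisfies `arc((u•V) e) ≤ C·√θ + c∕N` for every `V`. [folklore] -/
theorem exists_gauge_sqrtBound_of_trivialRegime (F : T3Family) (J : ℕ) (hNpos : 0 < (F.P J).sitesPerDir 0) {N₀ : ℕ} {θ₀ θ C c : ℝ}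
    (hC0 : 0 ≤ C) (hC : π ≤ C * Real.sqrt θ₀) (hc : (N₀ : ℝ) * π ≤ c) (hreg : (F.P J).sitesPerDir 0 ≤ N₀ ∨ θ₀ ≤ θ)
    (V : GaugeField (F.P J) 0 (Matrix.specialUnitaryGroup (Fin 2) ℂ)) :
    ∃ u : GaugeTransf (F.P J) 0 (Matrix.specialUnitaryGroup (Fin 2) ℂ),
      ∀ e, ‖logVec (su2Quat (GaugeField.gaugeAct u V e))‖ ≤ C * Real.sqrt θ + c / (((F.P J).sitesPerDir 0 : ℕ) : ℝ) := by
  rcases hreg with hN | hθ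
  · exact exists_gauge_sqrtBound_of_sitesPerDir_le F J hN hNpos hC0 hc V
  · exact exists_gauge_sqrtBound_of_le_theta F J hNpos hθ hC (le_trans (by positivity) hc) V

end Summit.QuantumFields.YangMills.Theorems.FluctuationComparisonRegPrIntLS2BetaSqrtGaugeTrivialRegimes

end
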